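import Mathlib.MeasureTheory.Function.ContinuousMapDense
import Summits.QuantumFields.GaugeBoot.RPFormContinuity
import Summits.QuantumFields.GaugeBoot.BootstrapDiagonalRPWitness
import Summits.QuantumFields.GaugeBoot.BootstrapAllCuts
import HarnessLib

/-!
# Reflection-positivity cuts are decided by POLYNOMIAL observables: a density theorem on the torus
(gauge-boot, L3 ↔ L1)

HONEST FRAMING (cell `pub-gaugeboot`, page 1 of every file): the venture produces certified bounds
on lattice expectations at stated coupling, gauge group, dimension and torus size; NOT a mass gap,
NOT a continuum limit, NOT a string tension; NOT Yang–Mills-summit-bearing (barriers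
`FixedCouplingUltralocality`, `PerturbativeInvisibility`). Structural measure theory; it certifies
no number.

## Content

The cell's torus reflection-positivity statements (`DiagonalReflectionPositive`, `InnerDiagonalRP`,
the tree's site/link RP) quantify over all bounded MEASURABLE complex observables `F` supported in a
set `S` of links: `0 ≤ ∫ (F∘Θ)‾ F dμ`. A lattice bootstrap only ever sees POLYNOMIAL (real) test
functions: its cuts are `0 ≤ φ ((p ∘ Θ) · p)` for `p ∈ polyAlgebra`, `DependsOn p S`. This module
proves that on the finite torus the two are EQUIVALENT for every probability measure `μ` preserved
by an involution `Θ` (`rp_of_poly_rp`; the converse is trivial), so that each packaged NEGATIVE RP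
theorem of the cell becomes an inconsistency statement for the corresponding cut family
(`BootstrapDiagonalCutsTable.lean`), exactly as each positive one is a soundness statement.

* `exists_comp_restrict_mem_polyAlgebra` — polynomial observables of the sub-family `S` of links
  pull back to polynomial observables of the torus depending only on `S`;
* ★★ `exists_poly_dependsOn_eLpNorm_sub_le` — DENSITY: a bounded measurable real observable depending
  only on the links of `S` is within `ε` in `L²(μ)` of a POLYNOMIAL observable depending only on the
  links of `S` (bounded continuous functions are dense in `L²` of the marginal on `S → G`, Mathlib
  `MemLp.exists_boundedContinuous_eLpNorm_sub_le`; Stone–Weierstrass `polyAlgebra_topologicalClosure`);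
  `exists_poly_pair_approx_complex` — complex form `q₁ + i q₂`;
* `rpForm_poly_pair_nonneg` — for a `μ`-preserving involution `Θ` the real form is symmetric
  (`RPDensity.integral_comp_mul_comm`), so real polynomial RP on `S` gives `0 ≤ ∫ (K∘Θ)‾ K dμ` for
  `K = q₁ + i q₂`;
* ★★★ `rp_of_poly_rp` — if `0 ≤ ∫ p(ΘU) p(U) dμ` for every `p ∈ polyAlgebra r` with `DependsOn p S`,
  then `0 ≤ ∫ (F∘Θ)‾ F dμ` for every bounded measurable complex `F` with `DependsOn F S` (the form is
  `L²`-continuous, `RPDensity.rpForm_sub_le`, and `{z : 0 ≤ z}` is closed in `ℂ`).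

References: K. Osterwalder, E. Seiler, Ann. Phys. 110 (1978) 440 §2; J. Glimm, A. Jaffe, Quantum
Physics (1987) §6.1 (RP is closed under limits); V. Kazakov, Z. Zheng, arXiv:2203.11360 §3.1
(RP cuts on Wilson-loop data). Standard measure theory; folklore.
-/

noncomputable section

open MeasureTheory Filter Topology NormedSpace
open scoped ENNReal ComplexConjugate InnerProductSpace ComplexOrder
open Literature.MathematicalPhysics.QuantumFieldTheory (LatticeRep Site Edge GaugeConfig)

namespace Summit.QuantumFields.GaugeBoot


/-! ## Density of polynomial observables among the `S`-supported ones, in `L²(μ)` -/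

section Density

variable {d L : ℕ} [NeZero L] {G : Type*} [Group G] [TopologicalSpace G] [IsTopologicalGroup G]
  [CompactSpace G] [T2Space G] [SecondCountableTopology G] [MeasurableSpace G] [BorelSpace G]
  (r : LatticeRep G)

omit [NeZero L] [IsTopologicalGroup G] [CompactSpace G] [T2Space G] [SecondCountableTopology G]
  [MeasurableSpace G] [BorelSpace G] in
/-- **Polynomial observables of a sub-family `S` of links pull back to polynomial observables of the
torus** (which then depend only on the links of `S`). -/
theorem exists_comp_restrict_mem_polyAlgebra (S : Set (Edge d L)) {p : C(↥S → G, ℝ)}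
    (hp : p ∈ polyAlgebra (ι := ↥S) r) :
    ∃ q ∈ polyAlgebra (ι := Edge d L) r, ∀ U : GaugeConfig d L G, q U = p (fun e : ↥S => U e.1) := by
  set res : C(GaugeConfig d L G, ↥S → G) :=
    ⟨fun U e => U e.1, continuous_pi fun e => continuous_apply _⟩ with hres
  refine ⟨p.comp res, ?_, fun U => rfl⟩
  have h : polyAlgebra (ι := ↥S) r ≤ (polyAlgebra (ι := Edge d L) r).comap
      (ContinuousMap.compRightAlgHom ℝ ℝ res) := by
    refine Algebra.adjoin_le ?_
    rintro _ (⟨⟨e, a, b⟩, rfl⟩ | ⟨⟨e, a, b⟩, rfl⟩)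
    · change (reEntry r e a b).comp res ∈ polyAlgebra (ι := Edge d L) r
      have : (reEntry (ι := ↥S) r e a b).comp res = reEntry r e.1 a b := by ext U; rfl
      rw [this]
      exact reEntry_mem r _ a b
    · change (imEntry r e a b).comp res ∈ polyAlgebra (ι := Edge d L) r
      have : (imEntry (ι := ↥S) r e a b).comp res = imEntry r e.1 a b := by ext U; rfl
      rw [this]
      exact imEntry_mem r _ a b
  exact h hp

/-- ★★ **Density: an `S`-supported bounded measurable real observable is `L²(μ)`-close to an
`S`-supported POLYNOMIAL observable.** `μ` any probability measure on the torus configurations, `S`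
any set of links, `F` measurable with `|F| ≤ C` and `DependsOn F S`, `ε ≠ 0`: there is
`q ∈ polyAlgebra r` with `DependsOn q S` and `‖F - q‖_{L²(μ)} ≤ ε`. [folklore] -/
theorem exists_poly_dependsOn_eLpNorm_sub_le (μ : Measure (GaugeConfig d L G)) [IsProbabilityMeasure μ]
    (S : Set (Edge d L)) {F : GaugeConfig d L G → ℝ} (hF : Measurable F) {C : ℝ} (hC : ∀ U, |F U| ≤ C)
    (hFS : DependsOn F S) {ε : ℝ≥0∞} (hε : ε ≠ 0) :
    ∃ q ∈ polyAlgebra (ι := Edge d L) r, DependsOn (⇑q) S ∧ eLpNorm (F - ⇑q) 2 μ ≤ ε := by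
  classical
  -- the marginal on `S → G`
  set res : GaugeConfig d L G → (↥S → G) := fun U e => U e.1 with hres
  have hresm : Measurable res := measurable_pi_lambda _ fun e => measurable_pi_apply _
  set ν : Measure (↥S → G) := μ.map res with hν
  haveI : IsProbabilityMeasure ν := Measure.isProbabilityMeasure_map hresm.aemeasurable
  -- `F` factors through the marginal space
  set glue : (↥S → G) → GaugeConfig d L G := fun V e => if h : e ∈ S then V ⟨e, h⟩ else 1 with hglue
  have hgluem : Measurable glue := by
    refine measurable_pi_lambda _ fun e => ?_
    by_cases h : e ∈ S
    · simp only [hglue, h, ↓reduceDIte]; exact measurable_pi_apply _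
    · simp only [hglue, h, ↓reduceDIte]; exact measurable_const
  set Ft : (↥S → G) → ℝ := fun V => F (glue V) with hFt
  have hFt_eq : ∀ U, F U = Ft (res U) := fun U =>
    hFS fun e he => by simp only [hglue, hres, he, ↓reduceDIte]
  have hFtm : Measurable Ft := hF.comp hgluem
  have hFt_mem : MemLp Ft 2 ν :=
    MemLp.of_bound hFtm.aestronglyMeasurable C (ae_of_all _ fun V => by
      rw [Real.norm_eq_abs]; exact hC _)
  have hε2 : ε / 2 ≠ 0 := by simpa using hε
  -- a bounded continuous approximant on the marginal space
  obtain ⟨g, hg, -⟩ := hFt_mem.exists_boundedContinuous_eLpNorm_sub_le ENNReal.ofNat_ne_top hε2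
  -- a polynomial uniform approximant of `g`
  obtain ⟨δ, hδ0, hδε⟩ := exists_between (pos_iff_ne_zero.2 hε2)
  have hδtop : δ ≠ ∞ := ne_top_of_lt (hδε.trans_le le_top)
  have hδpos : 0 < δ.toReal := ENNReal.toReal_pos hδ0.ne' hδtop
  obtain ⟨pt, hpt_mem, hpt⟩ := Metric.mem_closure_iff.1
    (mem_closure_polyAlgebra (ι := ↥S) r (g : C(↥S → G, ℝ))) _ hδpos
  obtain ⟨q, hq, hqU⟩ := exists_comp_restrict_mem_polyAlgebra (d := d) (L := L) r S hpt_mem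
  refine ⟨q, hq, fun U V hUV => ?_, ?_⟩
  · rw [hqU, hqU]
    congr 1
    funext e
    exact hUV e.1 e.2
  · -- `‖F - q‖₂ = ‖Ft - pt‖_{L²(ν)} ≤ ‖Ft - g‖ + ‖g - pt‖ ≤ ε/2 + δ ≤ ε`
    have hsub : (F - ⇑q : GaugeConfig d L G → ℝ) = (Ft - ⇑pt) ∘ res := by
      funext U
      simp only [Pi.sub_apply, Function.comp_apply, hFt_eq U, hqU U]
      rfl
    have hgm : AEStronglyMeasurable (g : (↥S → G) → ℝ) ν := g.continuous.aestronglyMeasurable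
    have hptm : AEStronglyMeasurable (⇑pt : (↥S → G) → ℝ) ν := pt.continuous.aestronglyMeasurable
    have h1 : eLpNorm ((g : (↥S → G) → ℝ) - ⇑pt) 2 ν ≤ δ := by
      have hb : ∀ᵐ a ∂ν, ‖((g : (↥S → G) → ℝ) - ⇑pt) a‖ ≤ δ.toReal := ae_of_all _ fun a => by
        rw [Pi.sub_apply, Real.norm_eq_abs]
        have h := ContinuousMap.dist_apply_le_dist (f := (g : C(↥S → G, ℝ))) (g := pt) a
        rw [Real.dist_eq] at h
        exact h.trans hpt.le
      refine (eLpNorm_le_of_ae_bound hb).trans ?_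
      rw [measure_univ, ENNReal.one_rpow, one_mul, ENNReal.ofReal_toReal hδtop]
    rw [hsub, ← eLpNorm_map_measure ((hFtm.aestronglyMeasurable).sub pt.continuous.aestronglyMeasurable)
      hresm.aemeasurable]
    have hsplit : (Ft - ⇑pt : (↥S → G) → ℝ) = (Ft - (g : (↥S → G) → ℝ)) + ((g : (↥S → G) → ℝ) - ⇑pt) := by
      funext a; simp only [Pi.sub_apply, Pi.add_apply]; ring
    rw [hsplit]
    refine (eLpNorm_add_le (hFtm.aestronglyMeasurable.sub hgm) (hgm.sub hptm) one_le_two).trans ?_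
    calc eLpNorm (Ft - (g : (↥S → G) → ℝ)) 2 ν + eLpNorm ((g : (↥S → G) → ℝ) - ⇑pt) 2 ν
        ≤ ε / 2 + ε / 2 := add_le_add hg (h1.trans hδε.le)
      _ = ε := ENNReal.add_halves ε

/-- **Complex form of the density step**: a bounded measurable complex `S`-supported observable is
within `ε` in `L²(μ)` of `q₁ + i q₂` with `q₁, q₂` polynomial `S`-supported observables. -/
theorem exists_poly_pair_approx_complex (μ : Measure (GaugeConfig d L G)) [IsProbabilityMeasure μ]
    (S : Set (Edge d L)) {F : GaugeConfig d L G → ℂ} (hF : Measurable F) {C : ℝ} (hC : ∀ U, ‖F U‖ ≤ C)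
    (hFS : DependsOn F S) {ε : ℝ} (hε : 0 < ε) :
    ∃ q₁ ∈ polyAlgebra (ι := Edge d L) r, ∃ q₂ ∈ polyAlgebra (ι := Edge d L) r,
      DependsOn (⇑q₁) S ∧ DependsOn (⇑q₂) S ∧
        (eLpNorm (F - fun U => ((q₁ U : ℂ) + (q₂ U : ℂ) * Complex.I)) 2 μ).toReal ≤ ε := by
  classical
  have hε2 : ENNReal.ofReal (ε / 2) ≠ 0 := by
    simpa [ENNReal.ofReal_eq_zero, not_le] using half_pos hε
  have hre : ∀ U, |(F U).re| ≤ C := fun U => (Complex.abs_re_le_norm _).trans (hC U)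
  have him : ∀ U, |(F U).im| ≤ C := fun U => (Complex.abs_im_le_norm _).trans (hC U)
  obtain ⟨q₁, hq₁, hS₁, hε₁⟩ := exists_poly_dependsOn_eLpNorm_sub_le r μ S
    (Complex.measurable_re.comp hF) hre (fun U V h => by simp only [Function.comp_apply, hFS h]) hε2
  obtain ⟨q₂, hq₂, hS₂, hε₂⟩ := exists_poly_dependsOn_eLpNorm_sub_le r μ S
    (Complex.measurable_im.comp hF) him (fun U V h => by simp only [Function.comp_apply, hFS h]) hε2
  refine ⟨q₁, hq₁, q₂, hq₂, hS₁, hS₂, ?_⟩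
  set K : GaugeConfig d L G → ℂ := fun U => (q₁ U : ℂ) + (q₂ U : ℂ) * Complex.I with hK
  have hdecomp : F - K = (fun U => (((fun U => (F U).re) - ⇑q₁) U : ℂ)) +
      fun U => (((fun U => (F U).im) - ⇑q₂) U : ℂ) * Complex.I := by
    funext U
    simp only [hK, Pi.sub_apply, Pi.add_apply, Complex.ofReal_sub]
    rw [← Complex.re_add_im (F U)]
    simp only [Complex.add_re, Complex.ofReal_re, Complex.mul_re, Complex.I_re, mul_zero,
      Complex.ofReal_im, Complex.I_im, mul_one, sub_self, add_zero, Complex.add_im,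
      Complex.mul_im, zero_add]
    ring
  have hm1 : AEStronglyMeasurable (fun U => (((fun U => (F U).re) - ⇑q₁) U : ℂ)) μ :=
    (Complex.measurable_ofReal.comp ((Complex.measurable_re.comp hF).sub
      q₁.continuous.measurable)).aestronglyMeasurable
  have hm2 : AEStronglyMeasurable (fun U => (((fun U => (F U).im) - ⇑q₂) U : ℂ) * Complex.I) μ :=
    ((Complex.measurable_ofReal.comp ((Complex.measurable_im.comp hF).sub
      q₂.continuous.measurable)).mul_const _).aestronglyMeasurable
  have h1 : eLpNorm (fun U => (((fun U => (F U).re) - ⇑q₁) U : ℂ)) 2 μ =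
      eLpNorm ((fun U => (F U).re) - ⇑q₁) 2 μ :=
    eLpNorm_congr_norm_ae (ae_of_all _ fun U => by rw [Complex.norm_real])
  have h2 : eLpNorm (fun U => (((fun U => (F U).im) - ⇑q₂) U : ℂ) * Complex.I) 2 μ =
      eLpNorm ((fun U => (F U).im) - ⇑q₂) 2 μ :=
    eLpNorm_congr_norm_ae (ae_of_all _ fun U => by
      rw [norm_mul, Complex.norm_I, mul_one, Complex.norm_real])
  have hsum : eLpNorm (F - K) 2 μ ≤ ENNReal.ofReal (ε / 2) + ENNReal.ofReal (ε / 2) := by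
    rw [hdecomp]
    refine (eLpNorm_add_le hm1 hm2 one_le_two).trans ?_
    rw [h1, h2]
    exact add_le_add hε₁ hε₂
  have hfin : ENNReal.ofReal (ε / 2) + ENNReal.ofReal (ε / 2) ≠ ∞ := by simp
  calc (eLpNorm (F - K) 2 μ).toReal ≤ (ENNReal.ofReal (ε / 2) + ENNReal.ofReal (ε / 2)).toReal :=
        ENNReal.toReal_mono hfin hsum
    _ = ε := by
        rw [ENNReal.toReal_add ENNReal.ofReal_ne_top ENNReal.ofReal_ne_top,
          ENNReal.toReal_ofReal (by linarith)]
        ring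

end Density

/-! ## From polynomial RP to RP -/

section Closure

variable {d L : ℕ} [NeZero L] {G : Type*} [Group G] [TopologicalSpace G] [IsTopologicalGroup G]
  [CompactSpace G] [T2Space G] [SecondCountableTopology G] [MeasurableSpace G] [BorelSpace G]
  (r : LatticeRep G)

omit [IsTopologicalGroup G] [T2Space G] in
/-- **Real polynomial RP gives complex RP on `q₁ + i q₂`.** `μ` a probability measure preserved by the
involution `Θ`; if `0 ≤ ∫ p(ΘU) p(U) dμ` for all `S`-supported polynomial `p`, then for `S`-supported
polynomials `q₁, q₂` and `K = q₁ + i q₂`: `0 ≤ ∫ (K∘Θ)‾ K dμ` — the imaginary part vanishes by the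
symmetry `integral_comp_mul_comm`. -/
theorem rpForm_poly_pair_nonneg (μ : Measure (GaugeConfig d L G)) [IsProbabilityMeasure μ]
    {Θ : GaugeConfig d L G → GaugeConfig d L G} (hΘ : MeasurePreserving Θ μ μ)
    (hΘΘ : ∀ U, Θ (Θ U) = U) (S : Set (Edge d L))
    (hpoly : ∀ p ∈ polyAlgebra (ι := Edge d L) r, DependsOn (⇑p) S → 0 ≤ ∫ U, p (Θ U) * p U ∂μ)
    {q₁ q₂ : C(GaugeConfig d L G, ℝ)} (hq₁ : q₁ ∈ polyAlgebra (ι := Edge d L) r)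
    (hq₂ : q₂ ∈ polyAlgebra (ι := Edge d L) r) (hS₁ : DependsOn (⇑q₁) S) (hS₂ : DependsOn (⇑q₂) S) :
    0 ≤ ∫ U, conj ((q₁ (Θ U) : ℂ) + (q₂ (Θ U) : ℂ) * Complex.I) *
      ((q₁ U : ℂ) + (q₂ U : ℂ) * Complex.I) ∂μ := by
  have hΘm : Measurable Θ := hΘ.measurable
  -- integrability of the real pairings of continuous observables
  have hint : ∀ f g : C(GaugeConfig d L G, ℝ), Integrable (fun U => f (Θ U) * g U) μ := fun f g =>
    Integrable.of_bound ((f.continuous.measurable.comp hΘm).mul g.continuous.measurable).aestronglyMeasurable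
      (‖f‖ * ‖g‖) (ae_of_all _ fun U => by
        rw [norm_mul]
        exact mul_le_mul (f.norm_coe_le_norm _) (g.norm_coe_le_norm _) (norm_nonneg _) (norm_nonneg _))
  -- pointwise: `(a - b i)(c + e i) = (ac + be) + (ae - bc) i`
  have hpt : ∀ U, conj ((q₁ (Θ U) : ℂ) + (q₂ (Θ U) : ℂ) * Complex.I) * ((q₁ U : ℂ) + (q₂ U : ℂ) * Complex.I) =
      ((q₁ (Θ U) * q₁ U + q₂ (Θ U) * q₂ U : ℝ) : ℂ) +
        ((q₁ (Θ U) * q₂ U - q₂ (Θ U) * q₁ U : ℝ) : ℂ) * Complex.I := fun U => by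
    simp only [map_add, map_mul, Complex.conj_ofReal, Complex.conj_I]
    push_cast
    linear_combination (-((q₂ (Θ U) : ℂ) * (q₂ U : ℂ))) * Complex.I_mul_I
  simp_rw [hpt]
  have hAi : Integrable (fun U => ((q₁ (Θ U) * q₁ U + q₂ (Θ U) * q₂ U : ℝ) : ℂ)) μ :=
    ((hint q₁ q₁).add (hint q₂ q₂)).ofReal
  have hBi : Integrable (fun U => ((q₁ (Θ U) * q₂ U - q₂ (Θ U) * q₁ U : ℝ) : ℂ) * Complex.I) μ :=
    ((hint q₁ q₂).sub (hint q₂ q₁)).ofReal.mul_const _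
  rw [integral_add hAi hBi, integral_mul_const, integral_complex_ofReal, integral_complex_ofReal,
    integral_sub (hint q₁ q₂) (hint q₂ q₁), integral_add (hint q₁ q₁) (hint q₂ q₂),
    RPDensity.integral_comp_mul_comm hΘ hΘΘ q₁.continuous.measurable q₂.continuous.measurable, sub_self,
    Complex.ofReal_zero, zero_mul, add_zero, Complex.zero_le_real]
  exact add_nonneg (hpoly q₁ hq₁ hS₁) (hpoly q₂ hq₂ hS₂)

/-- ★★★ **Reflection positivity is decided by polynomial observables.** Let `μ` be a probability
measure on the torus configurations preserved by an involution `Θ`, `S` a set of links, and suppose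
`0 ≤ ∫ p(ΘU) p(U) dμ` for every POLYNOMIAL observable `p` with `DependsOn p S` (the bootstrap's cut
family). Then `0 ≤ ∫ (F∘Θ)‾ F dμ` (real and non-negative) for every bounded MEASURABLE complex
observable `F` with `DependsOn F S`. [folklore] -/
theorem rp_of_poly_rp (μ : Measure (GaugeConfig d L G)) [IsProbabilityMeasure μ]
    {Θ : GaugeConfig d L G → GaugeConfig d L G} (hΘ : MeasurePreserving Θ μ μ)
    (hΘΘ : ∀ U, Θ (Θ U) = U) (S : Set (Edge d L))
    (hpoly : ∀ p ∈ polyAlgebra (ι := Edge d L) r, DependsOn (⇑p) S → 0 ≤ ∫ U, p (Θ U) * p U ∂μ)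
    {F : GaugeConfig d L G → ℂ} (hF : Measurable F) (hFb : ∃ C : ℝ, ∀ U, ‖F U‖ ≤ C)
    (hFS : DependsOn F S) :
    0 ≤ ∫ U, conj (F (Θ U)) * F U ∂μ := by
  obtain ⟨CF, hCF⟩ := hFb
  set B : ℂ := ∫ U, conj (F (Θ U)) * F U ∂μ with hB
  set M : ℝ := (eLpNorm F 2 μ).toReal with hM
  have hM0 : 0 ≤ M := ENNReal.toReal_nonneg
  -- for every `η > 0`: `re B ≥ -η` and `|im B| ≤ η`
  have key : ∀ η : ℝ, 0 < η → -η ≤ B.re ∧ |B.im| ≤ η := by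
    intro η hη
    set ε : ℝ := min 1 (η / (2 * M + 1)) with hεdef
    have hε : 0 < ε := lt_min one_pos (div_pos hη (by linarith))
    have hε1 : ε ≤ 1 := min_le_left _ _
    have hεη : ε * (2 * M + 1) ≤ η := by
      have : ε ≤ η / (2 * M + 1) := min_le_right _ _
      rwa [le_div_iff₀ (by linarith)] at this
    obtain ⟨q₁, hq₁, q₂, hq₂, hS₁, hS₂, hFK⟩ := exists_poly_pair_approx_complex r μ S hF hCF hFS hε
    have hpos := rpForm_poly_pair_nonneg r μ hΘ hΘΘ S hpoly hq₁ hq₂ hS₁ hS₂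
    set K : GaugeConfig d L G → ℂ := fun U => (q₁ U : ℂ) + (q₂ U : ℂ) * Complex.I with hK
    have hposK : 0 ≤ ∫ U, conj (K (Θ U)) * K U ∂μ := by simpa only [hK] using hpos
    have hKm : Measurable K :=
      (Complex.measurable_ofReal.comp q₁.continuous.measurable).add
        ((Complex.measurable_ofReal.comp q₂.continuous.measurable).mul_const _)
    have hCK : ∀ U, ‖K U‖ ≤ ‖q₁‖ + ‖q₂‖ := fun U => by
      refine (norm_add_le _ _).trans (add_le_add ?_ ?_)
      · rw [Complex.norm_real]; exact q₁.norm_coe_le_norm U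
      · rw [norm_mul, Complex.norm_I, mul_one, Complex.norm_real]; exact q₂.norm_coe_le_norm U
    have hdiff := RPDensity.rpForm_sub_le hΘ hF hCF hKm hCK
    -- `‖K‖₂ ≤ ‖F‖₂ + ε`
    have hFm : MemLp F 2 μ := RPDensity.memLp_two_of_bound hF hCF
    have hKmm : MemLp K 2 μ := RPDensity.memLp_two_of_bound hKm hCK
    have hKnorm : (eLpNorm K 2 μ).toReal ≤ M + ε := by
      have htri : eLpNorm K 2 μ ≤ eLpNorm F 2 μ + eLpNorm (F - K) 2 μ := by
        have : K = F - (F - K) := by simp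
        rw [this]
        exact (eLpNorm_sub_le hFm.aestronglyMeasurable (hFm.sub hKmm).aestronglyMeasurable
          one_le_two).trans (by rw [← this])
      calc (eLpNorm K 2 μ).toReal ≤ (eLpNorm F 2 μ + eLpNorm (F - K) 2 μ).toReal :=
            ENNReal.toReal_mono (ENNReal.add_ne_top.2 ⟨hFm.eLpNorm_ne_top, (hFm.sub hKmm).eLpNorm_ne_top⟩)
              htri
        _ = M + (eLpNorm (F - K) 2 μ).toReal :=
            ENNReal.toReal_add hFm.eLpNorm_ne_top (hFm.sub hKmm).eLpNorm_ne_top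
        _ ≤ M + ε := by linarith
    have hbound : ‖B - ∫ U, conj (K (Θ U)) * K U ∂μ‖ ≤ η := by
      refine hdiff.trans ?_
      calc (eLpNorm (F - K) 2 μ).toReal * ((eLpNorm F 2 μ).toReal + (eLpNorm K 2 μ).toReal)
          ≤ ε * (M + (M + ε)) := mul_le_mul hFK (by linarith) (by positivity) hε.le
        _ ≤ ε * (2 * M + 1) := by nlinarith
        _ ≤ η := hεη
    obtain ⟨hKre, hKim⟩ := Complex.nonneg_iff.1 hposK
    have hre := (Complex.abs_re_le_norm _).trans hbound
    have him := (Complex.abs_im_le_norm _).trans hbound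
    rw [Complex.sub_re] at hre
    rw [Complex.sub_im, ← hKim, sub_zero] at him
    constructor
    · have := neg_abs_le (B.re - (∫ U, conj (K (Θ U)) * K U ∂μ).re)
      linarith
    · exact him
  have hre : 0 ≤ B.re := by
    by_contra hlt
    have hlt' : B.re < 0 := not_le.1 hlt
    have := (key (-B.re / 2) (by linarith)).1
    linarith
  have him : B.im = 0 := by
    by_contra hne
    have hpos : 0 < |B.im| := abs_pos.2 hne
    have := (key (|B.im| / 2) (by linarith)).2
    linarith
  exact Complex.nonneg_iff.2 ⟨hre, him.symm⟩

end Closure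

end Summit.QuantumFields.GaugeBoot

end
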